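import Literature.MathematicalPhysics.QuantumLattice.PairCorrelations
import HarnessLib

/-!
# Pair correlations: Yang's ODLRO criterion in `supRayleigh` form (proof)

Trunk T-QLATTICE, family `hubbard` (companion of
`Literature.MathematicalPhysics.QuantumLattice.PairCorrelations`, which defines
`Matrix.supRayleigh ρ = ⨆_{v† v = 1} re (v† ρ v)` and states the named fact
`hasODLRO_iff_supRayleigh`; this file only PROVES — it declares no definition and changes no
statement).

## Contents

* `re_star_dotProduct_mulVec_le_opNorm` — for a unit vector `v` (`v† v = 1`) and any square
  complex matrix `ρ`, `re (v† ρ v) ≤ ‖ρ‖_{ℓ² → ℓ²}` (Cauchy–Schwarz and the operator norm of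
  `Matrix.toEuclideanCLM ρ`); in particular the unit-sphere Rayleigh quotients are bounded above,
  so `Matrix.supRayleigh` is a genuine (conditionally complete) supremum;
* `exists_lt_rayleigh_of_lt_supRayleigh` — a nonnegative strict lower bound of `supRayleigh ρ`
  is exceeded by the Rayleigh quotient of some unit vector;
* the discharge **`hasODLRO_iff_supRayleigh_holds`** of `hasODLRO_iff_supRayleigh`.

## Proof

Yang's criterion for ODLRO of a Fermi system is that the two-particle reduced density matrix
`ρ₂` acquires an eigenvalue of the order of `N` (Yang, Rev. Mod. Phys. 34 (1962) 694, §4;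
restated in R. J. Finkelstein, *Thermodynamics and Statistical Physics* (1970), ch. 10, p. 126:
"the criterion for an E.B. (F.D.) condensation is that `ρ₁` (`ρ₂`) acquire an eigenvalue of the
order of `N`"). Wave0's `HasODLRO N ψ` phrases "largest eigenvalue `≥ c N`" variationally:
eventually in `L` there is a unit `v` with `re (v† ρ₂(ψ_L) v) ≥ c · N L`; the named fact
rephrases this as `c · N L ≤ supRayleigh ρ₂(ψ_L)` eventually. `→`: keep `c`; the witness's
Rayleigh quotient is `≤ supRayleigh` by `le_ciSup`, the family being bounded above by the operator
norm (`re_star_dotProduct_mulVec_le_opNorm`). `←`: trade `c` for `c / 2`; since `N L → ∞`,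
eventually `N L ≥ 1`, so `0 < (c/2) · N L < c · N L ≤ supRayleigh`, and a strict lower bound of a
real `⨆` over a nonempty family is exceeded by some member (`exists_lt_of_lt_ciSup`); the family
is nonempty because a real `⨆` over an empty type is `0` (`Real.iSup_of_isEmpty`), which the
strict positivity excludes. No physics enters: the equivalence is supremum bookkeeping.

## Sources

C. N. Yang, *Concept of off-diagonal long-range order and the quantum phases of liquid He and of
superconductors*, Rev. Mod. Phys. 34 (1962) 694, §4 (ODLRO of `ρ₂`: a largest eigenvalue of
order `N`) [cite: Yang1962, §4]; R. J. Finkelstein, *Thermodynamics and Statistical Physics: A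
Short Introduction* (Freeman 1970), ch. 10, p. 126 (Yang's criterion restated); M. Reed, B. Simon,
*Methods of Modern Mathematical Physics I*, §VI.1 (bounded operators, `|⟨x, T x⟩| ≤ ‖T‖ ‖x‖²`).
-/

noncomputable section

namespace Literature.MathematicalPhysics.QuantumLattice

open Matrix Finset Filter
open scoped InnerProductSpace

section RayleighBound

variable {m : Type*} [Fintype m]

/-- Cauchy–Schwarz plus the `ℓ²` operator norm: `re (v† ρ v) ≤ ‖ρ‖_{ℓ² → ℓ²}` for every unit
vector `v` (`v† v = 1`), where `‖ρ‖_{ℓ² → ℓ²}` is the norm of `Matrix.toEuclideanCLM ρ`, i.e. of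
`ρ` acting on `EuclideanSpace ℂ m`. Reed–Simon I, §VI.1. [folklore] -/
theorem re_star_dotProduct_mulVec_le_opNorm [DecidableEq m] (ρ : Matrix m m ℂ) {v : m → ℂ}
    (hv : star v ⬝ᵥ v = 1) :
    (star v ⬝ᵥ (ρ *ᵥ v)).re ≤ ‖Matrix.toEuclideanCLM (n := m) (𝕜 := ℂ) ρ‖ := by
  have hinner : ∀ a b : m → ℂ,
      star a ⬝ᵥ b = ⟪(WithLp.toLp 2 a : EuclideanSpace ℂ m), WithLp.toLp 2 b⟫_ℂ := fun a b => by
    rw [EuclideanSpace.inner_eq_star_dotProduct, dotProduct_comm]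
  set x : EuclideanSpace ℂ m := WithLp.toLp 2 v with hx
  have hx1 : ‖x‖ = 1 := by
    have h2 : ‖x‖ ^ 2 = (star v ⬝ᵥ v).re := by
      rw [hinner, ← inner_self_eq_norm_sq (𝕜 := ℂ)]
      rfl
    rw [hv, Complex.one_re, pow_eq_one_iff_of_nonneg (norm_nonneg _) two_ne_zero] at h2
    exact h2
  calc (star v ⬝ᵥ (ρ *ᵥ v)).re
      = (⟪x, Matrix.toEuclideanCLM (n := m) (𝕜 := ℂ) ρ x⟫_ℂ).re := by
        rw [hinner, hx, Matrix.toEuclideanCLM_toLp]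
    _ ≤ ‖x‖ * ‖Matrix.toEuclideanCLM (n := m) (𝕜 := ℂ) ρ x‖ :=
        (Complex.re_le_norm _).trans (norm_inner_le_norm _ _)
    _ ≤ ‖x‖ * (‖Matrix.toEuclideanCLM (n := m) (𝕜 := ℂ) ρ‖ * ‖x‖) := by
        gcongr
        exact ContinuousLinearMap.le_opNorm _ _
    _ = ‖Matrix.toEuclideanCLM (n := m) (𝕜 := ℂ) ρ‖ := by rw [hx1, one_mul, mul_one]

/-- Every unit-vector Rayleigh quotient is at most `supRayleigh ρ`: `le_ciSup`, the family being
bounded above by `‖ρ‖_{ℓ² → ℓ²}` (`re_star_dotProduct_mulVec_le_opNorm`). (This is the content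
of the named fact `Matrix.rayleigh_le_supRayleigh`, re-derived here from the operator-norm bound
to keep this file self-contained.) Yang, Rev. Mod. Phys. 34 (1962) 694, §4. [folklore] -/
theorem re_star_dotProduct_mulVec_le_supRayleigh (ρ : Matrix m m ℂ) {v : m → ℂ}
    (hv : star v ⬝ᵥ v = 1) : (star v ⬝ᵥ (ρ *ᵥ v)).re ≤ ρ.supRayleigh := by
  classical
  have hbdd : BddAbove (Set.range fun w : {w : m → ℂ // star w ⬝ᵥ w = 1} =>
      (star w.1 ⬝ᵥ (ρ *ᵥ w.1)).re) := by
    refine ⟨‖Matrix.toEuclideanCLM (n := m) (𝕜 := ℂ) ρ‖, ?_⟩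
    rintro _ ⟨w, rfl⟩
    exact re_star_dotProduct_mulVec_le_opNorm ρ w.2
  exact le_ciSup hbdd (⟨v, hv⟩ : {w : m → ℂ // star w ⬝ᵥ w = 1})

/-- A nonnegative strict lower bound of `supRayleigh ρ` is exceeded by the Rayleigh quotient of
some unit vector (the index type is then nonempty, since a real `⨆` over an empty type is `0`;
then `exists_lt_of_lt_ciSup`). Yang, Rev. Mod. Phys. 34 (1962) 694, §4. [folklore] -/
theorem exists_lt_rayleigh_of_lt_supRayleigh (ρ : Matrix m m ℂ) {b : ℝ} (hb : 0 ≤ b)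
    (h : b < ρ.supRayleigh) :
    ∃ v : m → ℂ, star v ⬝ᵥ v = 1 ∧ b < (star v ⬝ᵥ (ρ *ᵥ v)).re := by
  have hne : Nonempty {v : m → ℂ // star v ⬝ᵥ v = 1} := by
    by_contra hne
    rw [not_nonempty_iff] at hne
    rw [supRayleigh, Real.iSup_of_isEmpty] at h
    exact (not_lt.mpr hb) h
  obtain ⟨v, hv⟩ := exists_lt_of_lt_ciSup h
  exact ⟨v.1, v.2, hv⟩

end RayleighBound

universe u

/-- **Discharge of `hasODLRO_iff_supRayleigh`** (Wave0's variational `HasODLRO` versus the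
`λ_max(ρ₂^{(L)}) = supRayleigh ρ₂^{(L)} ≥ c · N L` form). `→`: keep `c`; the witnessing unit
vector's Rayleigh quotient is at most `supRayleigh` (`re_star_dotProduct_mulVec_le_supRayleigh`).
`←`: take `c / 2`; since `N L → ∞`, eventually `N L ≥ 1`, so
`0 < (c/2) N L < c N L ≤ supRayleigh` and `exists_lt_rayleigh_of_lt_supRayleigh` yields the unit
vector. Yang, Rev. Mod. Phys. 34 (1962) 694, §4 (ODLRO ⇔ `ρ₂` has an eigenvalue of order `N`);
Finkelstein (1970), ch. 10, p. 126. [cite: Yang1962, §4] -/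
theorem hasODLRO_iff_supRayleigh_holds : hasODLRO_iff_supRayleigh.{u} := by
  intro κ _ _ N ψ
  constructor
  · rintro ⟨hnorm, hN, c, hc, hev⟩
    refine ⟨hnorm, hN, c, hc, ?_⟩
    filter_upwards [hev] with L hL
    obtain ⟨v, hv, hcv⟩ := hL
    exact hcv.trans (re_star_dotProduct_mulVec_le_supRayleigh _ hv)
  · rintro ⟨hnorm, hN, c, hc, hev⟩
    refine ⟨hnorm, hN, c / 2, half_pos hc, ?_⟩
    filter_upwards [hev, hN.eventually (eventually_ge_atTop 1)] with L hL h1L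
    have h1 : (1 : ℝ) ≤ N L := by exact_mod_cast h1L
    have hlt : c / 2 * (N L : ℝ) < (twoParticleRDM (ψ L)).supRayleigh :=
      lt_of_lt_of_le (by nlinarith) hL
    obtain ⟨v, hv, hcv⟩ :=
      exists_lt_rayleigh_of_lt_supRayleigh _ (by positivity) hlt
    exact ⟨v, hv, hcv.le⟩

end Literature.MathematicalPhysics.QuantumLattice
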